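import Summits.AtomisticToContinuum.BoseEinsteinCondensation.Theorems.BECConjugateDominationHardCoreExtensionTruncationReduction
import Summits.AtomisticToContinuum.BoseEinsteinCondensation.Theorems.BECConjugateDominationHardCoreExtensionGradientCauchy
import Literature.MathematicalPhysics.QuantumManyBody.PeriodicKineticBudget
import Literature.MathematicalPhysics.QuantumManyBody.PeriodicClusteringFromKyFanGap
import Literature.MathematicalPhysics.QuantumManyBody.PeriodicBoseGasMomentumSector
import Mathlib.MeasureTheory.Integral.MeanInequalities
import HarnessLib

/-!
# Trace-Cauchy estimate for near-optimal orthonormal pairs of two truncations (line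
# `third-law-current-floor`, crux `HardCoreExtension`, stmt-AtomisticToContinuum-11786; stub Q2
# `stub_traceCauchy_of` of the (α'₂) pair programme)

At fixed `(N, L)` let `wₘ = min(v, m) ≤ wₙ = min(v, n)` (`m ≤ n`) be two truncations of a measurable pair
potential `v`, `K₂(w) = kyFanTwo w N L` the Ky Fan two-level (infimum of `E_w(Ψ₁) + E_w(Ψ₂)` over
`L²(cell)`-orthogonal pairs of periodic trial states) and `q_w(u) = ∫_cell |∇u|² + W_w |u|²` the (unnormalised)
energy form. If `Φ = (Φ₁, Φ₂)` is a `δ`-optimal orthonormal pair for `K₂(wₘ)`, `Ψ = (Ψ₁, Ψ₂)` a `δ`-optimal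
orthonormal pair for `K₂(wₙ) < ⊤`, and the pairs are componentwise `L²(cell)`-close,
`∫_cell |Ψᵢ - Φᵢ|² ≤ η ≤ 1/16`, then

  `∑ᵢ q_{wₘ}(Ψᵢ - Φᵢ) ≤ 2 (K₂(wₙ) - K₂(wₘ)) + 4δ + 64 √η (K₂(wₙ) + δ)`,

GIVEN the Gram–Schmidt lemma with energy control (stub Q1, the antecedent of the implication proved here).
Proof: the parallelogram law for the `wₘ`-form on each component (`lintegral_periodicEnergy_add_add_sub`),
`q(sᵢ) + q(dᵢ) = 2 q(Ψᵢ) + 2 q(Φᵢ)` with `sᵢ = Ψᵢ + Φᵢ`, `dᵢ = Ψᵢ - Φᵢ`; monotonicity `q_{wₘ} ≤ q_{wₙ}`; and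
the lower bound `4 K₂(wₘ) ≤ (1 + 16√η) ∑ᵢ q(sᵢ)` obtained from Gram–Schmidt applied to the half sums
`uᵢ = sᵢ / 2` (masses in `[1 - η/4, 1]`, overlap `|⟨u₁, u₂⟩| = ¼ |⟨d₁, Φ₂⟩ + ⟨Φ₁, d₂⟩| ≤ √η / 2` by the
orthogonality of both pairs and Cauchy–Schwarz on the cell). The rest is `ℝ≥0∞` bookkeeping
(`TraceCauchy.bookkeeping`). This is the two-level analogue of `stub_truncationMinimisersGradientCauchy`
(`…HardCoreExtensionGradientCauchy.lean`). [folklore; the convexity argument of LiebLoss2001 Thm 11.8]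
-/

noncomputable section

namespace Summit.AtomisticToContinuum.BoseEinsteinCondensation.Cruxes.HardCoreExtension.ThirdLawCurrentFloor

open MeasureTheory Filter
open scoped ENNReal NNReal BigOperators Topology ComplexConjugate
open Literature.MathematicalPhysics.QuantumManyBody.BoseGas

namespace TraceCauchy

variable {N : ℕ} {L : ℝ}

/-! ### The Ky Fan two-level is monotone in the potential -/

/-- `w ↦ K₂(w) = kyFanTwo w N L` is monotone (pointwise order of pair potentials). [folklore] -/
theorem kyFanTwo_mono_of_le {w₁ w₂ : ℝ → ℝ≥0∞} (hw : ∀ r, w₁ r ≤ w₂ r) :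
    kyFanTwo w₁ N L ≤ kyFanTwo w₂ N L := by
  unfold kyFanTwo
  exact iInf_mono fun Ψ₁ => iInf_mono fun Ψ₂ => iInf_mono fun _ =>
    add_le_add (periodicEnergy_mono_of_le hw Ψ₁) (periodicEnergy_mono_of_le hw Ψ₂)

/-! ### Cauchy–Schwarz on the cell -/

/-- **Cauchy–Schwarz on the cell**: `‖∫_cell conj(f) g‖ ≤ √(∫_cell |f|²) √(∫_cell |g|²)` for continuous
`f, g` of finite cell norm (Hölder with `p = q = 2` for the lower Lebesgue integral). [folklore] -/
theorem norm_integral_conj_mul_le (L : ℝ) {f g : Config N → ℂ} (hf : Continuous f)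
    (hg : Continuous g) (hf2 : ∫⁻ X in cellN N L, ((‖f X‖₊ : ℝ≥0∞)) ^ 2 ≠ ⊤)
    (hg2 : ∫⁻ X in cellN N L, ((‖g X‖₊ : ℝ≥0∞)) ^ 2 ≠ ⊤) :
    ‖∫ X in cellN N L, conj (f X) * g X‖ ≤
      Real.sqrt ((∫⁻ X in cellN N L, ((‖f X‖₊ : ℝ≥0∞)) ^ 2).toReal) *
        Real.sqrt ((∫⁻ X in cellN N L, ((‖g X‖₊ : ℝ≥0∞)) ^ 2).toReal) := by
  -- adapted from `enorm_integral_conj_mul_le` of `Literature/…/PenroseOnsager1956Proofs.lean`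
  have hH := ENNReal.lintegral_mul_le_Lp_mul_Lq (volume.restrict (cellN N L))
    Real.HolderConjugate.two_two hf.measurable.enorm.aemeasurable hg.measurable.enorm.aemeasurable
  have h1 : ‖∫ X in cellN N L, conj (f X) * g X‖ₑ ≤
      (∫⁻ X in cellN N L, ((‖f X‖₊ : ℝ≥0∞)) ^ 2) ^ (1 / 2 : ℝ) *
        (∫⁻ X in cellN N L, ((‖g X‖₊ : ℝ≥0∞)) ^ 2) ^ (1 / 2 : ℝ) :=
    calc ‖∫ X in cellN N L, conj (f X) * g X‖ₑ ≤ ∫⁻ X in cellN N L, ‖conj (f X) * g X‖ₑ :=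
        enorm_integral_le_lintegral_enorm _
      _ = ∫⁻ X in cellN N L, ‖f X‖ₑ * ‖g X‖ₑ := by simp_rw [enorm_mul, RCLike.enorm_conj]
      _ ≤ _ := by simpa only [Pi.mul_apply, ENNReal.rpow_two, enorm_eq_nnnorm] using hH
  have hR : (∫⁻ X in cellN N L, ((‖f X‖₊ : ℝ≥0∞)) ^ 2) ^ (1 / 2 : ℝ) *
      (∫⁻ X in cellN N L, ((‖g X‖₊ : ℝ≥0∞)) ^ 2) ^ (1 / 2 : ℝ) ≠ ⊤ :=
    ENNReal.mul_ne_top (ENNReal.rpow_ne_top_of_nonneg (by norm_num) hf2)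
      (ENNReal.rpow_ne_top_of_nonneg (by norm_num) hg2)
  have h2 := ENNReal.toReal_mono hR h1
  rw [toReal_enorm, ENNReal.toReal_mul, ← ENNReal.toReal_rpow, ← ENNReal.toReal_rpow] at h2
  rwa [Real.sqrt_eq_rpow, Real.sqrt_eq_rpow]

/-! ### The half sums `uᵢ = (Ψᵢ + Φᵢ)/2`: regularity, masses, overlap -/

/-- The constant `c = 1/2`: `|c|² = 4⁻¹` in `ℝ≥0∞` and `‖conj(c) c‖ = 1/4`. [folklore] -/
theorem half_facts : ((‖((1 / 2 : ℝ) : ℂ)‖₊ : ℝ≥0∞)) ^ 2 = 4⁻¹ ∧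
    ‖conj ((1 / 2 : ℝ) : ℂ) * ((1 / 2 : ℝ) : ℂ)‖ = 1 / 4 := by
  have hn : ‖((1 / 2 : ℝ) : ℂ)‖ = 1 / 2 := by
    rw [Complex.norm_real, Real.norm_of_nonneg (by norm_num)]
  refine ⟨?_, ?_⟩
  · rw [← enorm_eq_nnnorm, ← ofReal_norm, ← ENNReal.ofReal_pow (norm_nonneg _), hn,
      show ((1 : ℝ) / 2) ^ 2 = (4 : ℝ)⁻¹ by norm_num,
      ENNReal.ofReal_inv_of_pos (by norm_num : (0 : ℝ) < 4), ENNReal.ofReal_ofNat]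
  · rw [norm_mul, Complex.norm_conj, hn]; norm_num

/-- Regularity of `c (Ψ + Φ)` for two periodic trial states: `C¹`, periodic, Bose-symmetric. [folklore] -/
theorem halfSum_regular (Ψ Φ : PeriodicTrialState N L) (c : ℂ) :
    ContDiff ℝ 1 (fun X => c * (Ψ.ψ X + Φ.ψ X)) ∧
    (∀ (X : Config N) (i : Fin N) (k : Fin 3),
      c * (Ψ.ψ (X + Pi.single i (EuclideanSpace.single k L)) +
        Φ.ψ (X + Pi.single i (EuclideanSpace.single k L))) = c * (Ψ.ψ X + Φ.ψ X)) ∧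
    (∀ (σ : Equiv.Perm (Fin N)) (X : Config N),
      c * (Ψ.ψ (X ∘ σ) + Φ.ψ (X ∘ σ)) = c * (Ψ.ψ X + Φ.ψ X)) :=
  ⟨contDiff_const.mul (Ψ.contDiff.add Φ.contDiff), fun X i k => by rw [Ψ.periodic, Φ.periodic],
    fun σ X => by rw [Ψ.symm, Φ.symm]⟩

/-- **Masses of the half sums.** If `∫_cell |Ψ - Φ|² ≤ η ≤ 1/16` for two trial states then, with `|c|² = 1/4`,
`1 - √η/2 ≤ ∫_cell |c(Ψ + Φ)|² ≤ 1 + √η/2` (parallelogram law for the cell norm: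
`‖Ψ + Φ‖² = 4 - ‖Ψ - Φ‖² ∈ [4 - η, 4]`, and `η/4 ≤ √η/2`). [folklore] -/
theorem halfSum_mass_bounds (Ψ Φ : PeriodicTrialState N L) {c : ℂ}
    (hc : ((‖c‖₊ : ℝ≥0∞)) ^ 2 = 4⁻¹) {η : ℝ} (hη : 0 ≤ η) (hη16 : η ≤ 1 / 16)
    (hd : ∫⁻ X in cellN N L, ((‖Ψ.ψ X - Φ.ψ X‖₊ : ℝ≥0∞)) ^ 2 ≤ ENNReal.ofReal η) :
    ENNReal.ofReal (1 - Real.sqrt η / 2) ≤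
        ∫⁻ X in cellN N L, ((‖c * (Ψ.ψ X + Φ.ψ X)‖₊ : ℝ≥0∞)) ^ 2 ∧
      ∫⁻ X in cellN N L, ((‖c * (Ψ.ψ X + Φ.ψ X)‖₊ : ℝ≥0∞)) ^ 2 ≤
        ENNReal.ofReal (1 + Real.sqrt η / 2) := by
  have hPM : (∫⁻ X in cellN N L, ((‖Ψ.ψ X + Φ.ψ X‖₊ : ℝ≥0∞)) ^ 2) +
      (∫⁻ X in cellN N L, ((‖Ψ.ψ X - Φ.ψ X‖₊ : ℝ≥0∞)) ^ 2) = 4 := by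
    rw [lintegral_cellN_sq_add_add_sub L Ψ.contDiff.continuous Φ.contDiff.continuous, Ψ.norm_eq,
      Φ.norm_eq]
    norm_num
  rw [lintegral_cellN_sq_const_mul L c (fun X => Ψ.ψ X + Φ.ψ X), hc]
  generalize (∫⁻ X in cellN N L, ((‖Ψ.ψ X + Φ.ψ X‖₊ : ℝ≥0∞)) ^ 2) = P at hPM ⊢
  generalize (∫⁻ X in cellN N L, ((‖Ψ.ψ X - Φ.ψ X‖₊ : ℝ≥0∞)) ^ 2) = M at hPM hd
  have h4 : (4 : ℝ≥0∞) ≠ ⊤ := by norm_num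
  have hP_top : P ≠ ⊤ := ne_top_of_le_ne_top h4 (hPM ▸ le_self_add)
  have hM_top : M ≠ ⊤ := ne_top_of_le_ne_top h4 (hPM ▸ le_add_self)
  have hsum : P.toReal + M.toReal = 4 := by
    rw [← ENNReal.toReal_add hP_top hM_top, hPM]; norm_num
  have hMle : M.toReal ≤ η := ENNReal.toReal_le_of_le_ofReal hη hd
  have hM0 : 0 ≤ M.toReal := ENNReal.toReal_nonneg
  have hs0 : 0 ≤ Real.sqrt η := Real.sqrt_nonneg η
  have hsq : η ≤ Real.sqrt η := Real.le_sqrt_of_sq_le (by nlinarith)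
  have hx_top : 4⁻¹ * P ≠ ⊤ := ENNReal.mul_ne_top (ENNReal.inv_ne_top.2 (by norm_num)) hP_top
  have hx : (4⁻¹ * P).toReal = P.toReal / 4 := by
    rw [ENNReal.toReal_mul, ENNReal.toReal_inv, ENNReal.toReal_ofNat]; ring
  constructor
  · rw [ENNReal.ofReal_le_iff_le_toReal hx_top, hx]; linarith
  · rw [ENNReal.le_ofReal_iff_toReal_le hx_top (by positivity), hx]; linarith

/-- **Overlap of the half sums.** For two `L²(cell)`-orthogonal pairs `(Φ₁, Φ₂)`, `(Ψ₁, Ψ₂)` of trial states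
with `∫_cell |Ψᵢ - Φᵢ|² ≤ η` and `‖conj(c) c‖ = 1/4`:
`|⟨c(Ψ₁ + Φ₁), c(Ψ₂ + Φ₂)⟩| = ¼ |⟨Ψ₁ - Φ₁, Φ₂⟩ + ⟨Φ₁, Ψ₂ - Φ₂⟩| ≤ √η / 2` (Cauchy–Schwarz). [folklore] -/
theorem norm_integral_halfSum_overlap_le (Φ₁ Φ₂ Ψ₁ Ψ₂ : PeriodicTrialState N L) {c : ℂ}
    (hc : ‖conj c * c‖ = 1 / 4) {η : ℝ} (hη : 0 ≤ η)
    (hΦorth : ∫ X in cellN N L, conj (Φ₁.ψ X) * Φ₂.ψ X = 0)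
    (hΨorth : ∫ X in cellN N L, conj (Ψ₁.ψ X) * Ψ₂.ψ X = 0)
    (hd₁ : ∫⁻ X in cellN N L, ((‖Ψ₁.ψ X - Φ₁.ψ X‖₊ : ℝ≥0∞)) ^ 2 ≤ ENNReal.ofReal η)
    (hd₂ : ∫⁻ X in cellN N L, ((‖Ψ₂.ψ X - Φ₂.ψ X‖₊ : ℝ≥0∞)) ^ 2 ≤ ENNReal.ofReal η) :
    ‖∫ X in cellN N L, conj (c * (Ψ₁.ψ X + Φ₁.ψ X)) * (c * (Ψ₂.ψ X + Φ₂.ψ X))‖ ≤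
      Real.sqrt η / 2 := by
  have hΦ₁c : Continuous Φ₁.ψ := Φ₁.contDiff.continuous
  have hΦ₂c : Continuous Φ₂.ψ := Φ₂.contDiff.continuous
  have hΨ₁c : Continuous Ψ₁.ψ := Ψ₁.contDiff.continuous
  have hΨ₂c : Continuous Ψ₂.ψ := Ψ₂.contDiff.continuous
  -- Cauchy–Schwarz for the two cross terms
  have hA : ‖∫ X in cellN N L, conj (Ψ₁.ψ X - Φ₁.ψ X) * Φ₂.ψ X‖ ≤ Real.sqrt η := by
    refine (norm_integral_conj_mul_le L (hΨ₁c.sub hΦ₁c) hΦ₂c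
      (ne_top_of_le_ne_top ENNReal.ofReal_ne_top hd₁)
      (by rw [Φ₂.norm_eq]; exact ENNReal.one_ne_top)).trans ?_
    rw [Φ₂.norm_eq, ENNReal.toReal_one, Real.sqrt_one, mul_one]
    exact Real.sqrt_le_sqrt (ENNReal.toReal_le_of_le_ofReal hη hd₁)
  have hB : ‖∫ X in cellN N L, conj (Φ₁.ψ X) * (Ψ₂.ψ X - Φ₂.ψ X)‖ ≤ Real.sqrt η := by
    refine (norm_integral_conj_mul_le L hΦ₁c (hΨ₂c.sub hΦ₂c)
      (by rw [Φ₁.norm_eq]; exact ENNReal.one_ne_top)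
      (ne_top_of_le_ne_top ENNReal.ofReal_ne_top hd₂)).trans ?_
    rw [Φ₁.norm_eq, ENNReal.toReal_one, Real.sqrt_one, one_mul]
    exact Real.sqrt_le_sqrt (ENNReal.toReal_le_of_le_ofReal hη hd₂)
  -- expand the product using both orthogonalities
  have hprod : (fun X => conj (c * (Ψ₁.ψ X + Φ₁.ψ X)) * (c * (Ψ₂.ψ X + Φ₂.ψ X))) =
      fun X => conj c * c * ((conj (Ψ₁.ψ X) * Ψ₂.ψ X + 3 * (conj (Φ₁.ψ X) * Φ₂.ψ X)) +
        (conj (Ψ₁.ψ X - Φ₁.ψ X) * Φ₂.ψ X + conj (Φ₁.ψ X) * (Ψ₂.ψ X - Φ₂.ψ X))) := by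
    funext X; simp only [map_mul, map_add, map_sub]; ring
  have hi1 : IntegrableOn (fun X => conj (Ψ₁.ψ X) * Ψ₂.ψ X) (cellN N L) :=
    integrableOn_cellN (hΨ₁c.star.mul hΨ₂c) L
  have hi2 : IntegrableOn (fun X => 3 * (conj (Φ₁.ψ X) * Φ₂.ψ X)) (cellN N L) :=
    integrableOn_cellN (continuous_const.mul (hΦ₁c.star.mul hΦ₂c)) L
  have hi3 : IntegrableOn (fun X => conj (Ψ₁.ψ X - Φ₁.ψ X) * Φ₂.ψ X) (cellN N L) :=
    integrableOn_cellN ((hΨ₁c.sub hΦ₁c).star.mul hΦ₂c) L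
  have hi4 : IntegrableOn (fun X => conj (Φ₁.ψ X) * (Ψ₂.ψ X - Φ₂.ψ X)) (cellN N L) :=
    integrableOn_cellN (hΦ₁c.star.mul (hΨ₂c.sub hΦ₂c)) L
  have hi12 : IntegrableOn (fun X => conj (Ψ₁.ψ X) * Ψ₂.ψ X + 3 * (conj (Φ₁.ψ X) * Φ₂.ψ X))
      (cellN N L) := hi1.add hi2
  have hi34 : IntegrableOn (fun X => conj (Ψ₁.ψ X - Φ₁.ψ X) * Φ₂.ψ X +
      conj (Φ₁.ψ X) * (Ψ₂.ψ X - Φ₂.ψ X)) (cellN N L) := hi3.add hi4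
  rw [hprod, integral_const_mul, integral_add hi12 hi34, integral_add hi1 hi2, integral_const_mul,
    integral_add hi3 hi4, hΨorth, hΦorth]
  simp only [mul_zero, zero_add]
  rw [norm_mul, hc]
  calc 1 / 4 * ‖(∫ X in cellN N L, conj (Ψ₁.ψ X - Φ₁.ψ X) * Φ₂.ψ X) +
        ∫ X in cellN N L, conj (Φ₁.ψ X) * (Ψ₂.ψ X - Φ₂.ψ X)‖
      ≤ 1 / 4 * (Real.sqrt η + Real.sqrt η) :=
        mul_le_mul_of_nonneg_left ((norm_add_le _ _).trans (add_le_add hA hB)) (by norm_num)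
    _ = Real.sqrt η / 2 := by ring

/-! ### The `ℝ≥0∞` bookkeeping -/

/-- **Bookkeeping.** From the two parallelogram identities `Sᵢ + Dᵢ = 2Aᵢ + 2Bᵢ`, near-optimality
`A₁ + A₂ ≤ Kₙ + d`, `B₁ + B₂ ≤ Kₘ + d`, the Gram–Schmidt lower bound `Kₘ ≤ (1 + X)(S₁ + S₂)/4` and
`Kₘ ≤ Kₙ < ⊤`: `D₁ + D₂ ≤ 2(Kₙ - Kₘ) + 4d + 4X(Kₙ + d)`. [folklore] -/
theorem bookkeeping {S₁ S₂ D₁ D₂ A₁ A₂ B₁ B₂ Km Kn d X Y R : ℝ≥0∞} (hKmn : Km ≤ Kn) (hKn : Kn ≠ ⊤)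
    (hpar₁ : S₁ + D₁ = 2 * A₁ + 2 * B₁) (hpar₂ : S₂ + D₂ = 2 * A₂ + 2 * B₂)
    (hA : A₁ + A₂ ≤ Kn + d) (hB : B₁ + B₂ ≤ Km + d) (hlow : Km ≤ Y * (4⁻¹ * S₁ + 4⁻¹ * S₂))
    (hY : Y = 1 + X) (hR : X * 4 = R) :
    D₁ + D₂ ≤ 2 * (Kn - Km) + 4 * d + R * (Kn + d) := by
  have hKm : Km ≠ ⊤ := ne_top_of_le_ne_top hKn hKmn
  -- `T' = Σᵢ (q(sᵢ) + q(dᵢ)) ≤ 2(Kₙ + d) + 2(Kₘ + d)`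
  have hT : S₁ + D₁ + (S₂ + D₂) ≤ 2 * (Kn + d) + 2 * (Km + d) := by
    rw [hpar₁, hpar₂]
    calc 2 * A₁ + 2 * B₁ + (2 * A₂ + 2 * B₂) = 2 * (A₁ + A₂) + 2 * (B₁ + B₂) := by ring
      _ ≤ 2 * (Kn + d) + 2 * (Km + d) := add_le_add (mul_le_mul' le_rfl hA) (mul_le_mul' le_rfl hB)
  have hS : S₁ + S₂ ≤ 4 * (Kn + d) :=
    calc S₁ + S₂ ≤ S₁ + D₁ + (S₂ + D₂) := add_le_add le_self_add le_self_add
      _ ≤ 2 * (Kn + d) + 2 * (Km + d) := hT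
      _ ≤ 2 * (Kn + d) + 2 * (Kn + d) := by gcongr
      _ = 4 * (Kn + d) := by ring
  -- `4 Kₘ ≤ Σᵢ q(sᵢ) + R (Kₙ + d)`
  have h4 : 4 * Km ≤ S₁ + S₂ + R * (Kn + d) :=
    calc 4 * Km ≤ 4 * (Y * (4⁻¹ * S₁ + 4⁻¹ * S₂)) := mul_le_mul' le_rfl hlow
      _ = 4 * 4⁻¹ * ((1 + X) * (S₁ + S₂)) := by rw [hY]; ring
      _ = S₁ + S₂ + X * (S₁ + S₂) := by
        rw [ENNReal.mul_inv_cancel (by norm_num) (by norm_num), one_mul, add_mul, one_mul]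
      _ ≤ S₁ + S₂ + X * (4 * (Kn + d)) := by gcongr
      _ = S₁ + S₂ + R * (Kn + d) := by rw [← mul_assoc, hR]
  have h2 : 2 * Kn = 2 * (Kn - Km) + 2 * Km := by rw [← mul_add, tsub_add_cancel_of_le hKmn]
  have hkey : D₁ + D₂ + 4 * Km ≤ 2 * (Kn - Km) + 4 * d + R * (Kn + d) + 4 * Km :=
    calc D₁ + D₂ + 4 * Km ≤ D₁ + D₂ + (S₁ + S₂ + R * (Kn + d)) := add_le_add le_rfl h4
      _ = S₁ + D₁ + (S₂ + D₂) + R * (Kn + d) := by ring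
      _ ≤ 2 * (Kn + d) + 2 * (Km + d) + R * (Kn + d) := add_le_add hT le_rfl
      _ = 2 * Kn + 2 * Km + 4 * d + R * (Kn + d) := by ring
      _ = 2 * (Kn - Km) + 2 * Km + 2 * Km + 4 * d + R * (Kn + d) := by rw [h2]
      _ = 2 * (Kn - Km) + 4 * d + R * (Kn + d) + 4 * Km := by ring
  exact ENNReal.le_of_add_le_add_right (ENNReal.mul_ne_top (by norm_num) hKm) hkey

end TraceCauchy

open TraceCauchy

/-- **Q2 `stub_traceCauchy_of`** (trace-Cauchy estimate for near-optimal orthonormal pairs of two truncations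
`wₘ ≤ wₙ`, `m ≤ n`, from the Gram–Schmidt lemma Q1 taken as antecedent). With `Φ` a `δ`-optimal orthonormal
pair for `K₂(wₘ)`, `Ψ` a `δ`-optimal orthonormal pair for `K₂(wₙ) < ⊤`, componentwise `L²(cell)`-close
(`∫|Ψᵢ - Φᵢ|² ≤ η ≤ 1/16`):
`∑ᵢ q_{wₘ}(Ψᵢ - Φᵢ) ≤ 2(K₂(wₙ) - K₂(wₘ)) + 4δ + 64√η (K₂(wₙ) + δ)`. Proof: parallelogram law for the `wₘ`-form
(`lintegral_periodicEnergy_add_add_sub`) on each component, monotonicity `q_{wₘ} ≤ q_{wₙ}`, and the lower bound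
`4K₂(wₘ) ≤ (1 + 16√η) ∑ᵢ q_{wₘ}(Ψᵢ + Φᵢ)` from Q1 applied to `uᵢ = (Ψᵢ + Φᵢ)/2` (masses `1 - η/4 ≤ ‖uᵢ‖² ≤ 1`,
overlap `|⟨u₁,u₂⟩| = ¼|⟨Ψ₁-Φ₁,Φ₂⟩ + ⟨Φ₁,Ψ₂-Φ₂⟩| ≤ √η/2` by Cauchy–Schwarz). [folklore] -/
theorem stub_traceCauchy_of :
    (∀ (w : ℝ → ℝ≥0∞), Measurable w → ∀ (N : ℕ) (L : ℝ), 0 < L → ∀ η : ℝ, 0 ≤ η → η ≤ 1 / 8 →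
      ∀ u₁ u₂ : Config N → ℂ, ContDiff ℝ 1 u₁ → ContDiff ℝ 1 u₂ →
        (∀ (X : Config N) (i : Fin N) (k : Fin 3), u₁ (X + Pi.single i (EuclideanSpace.single k L)) = u₁ X) →
        (∀ (X : Config N) (i : Fin N) (k : Fin 3), u₂ (X + Pi.single i (EuclideanSpace.single k L)) = u₂ X) →
        (∀ (σ : Equiv.Perm (Fin N)) (X : Config N), u₁ (X ∘ σ) = u₁ X) →
        (∀ (σ : Equiv.Perm (Fin N)) (X : Config N), u₂ (X ∘ σ) = u₂ X) →
        ENNReal.ofReal (1 - η) ≤ ∫⁻ X in cellN N L, ((‖u₁ X‖₊ : ℝ≥0∞)) ^ 2 →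
        ∫⁻ X in cellN N L, ((‖u₁ X‖₊ : ℝ≥0∞)) ^ 2 ≤ ENNReal.ofReal (1 + η) →
        ENNReal.ofReal (1 - η) ≤ ∫⁻ X in cellN N L, ((‖u₂ X‖₊ : ℝ≥0∞)) ^ 2 →
        ∫⁻ X in cellN N L, ((‖u₂ X‖₊ : ℝ≥0∞)) ^ 2 ≤ ENNReal.ofReal (1 + η) →
        ‖∫ X in cellN N L, conj (u₁ X) * u₂ X‖ ≤ η →
        ∃ Ψ₁ Ψ₂ : PeriodicTrialState N L, (∫ X in cellN N L, conj (Ψ₁.ψ X) * Ψ₂.ψ X = 0) ∧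
          periodicEnergy w Ψ₁ + periodicEnergy w Ψ₂ ≤ ENNReal.ofReal (1 + 32 * η) *
            ((∫⁻ X in cellN N L, kineticDensity u₁ X + periodicInteraction w L X * ((‖u₁ X‖₊ : ℝ≥0∞)) ^ 2) +
              ∫⁻ X in cellN N L, kineticDensity u₂ X + periodicInteraction w L X * ((‖u₂ X‖₊ : ℝ≥0∞)) ^ 2)) →
    ∀ (v : ℝ → ℝ≥0∞), Measurable v → ∀ (N : ℕ) (L : ℝ), 0 < L → ∀ (m n : ℕ), m ≤ n →
      ∀ (δ η : ℝ), 0 ≤ δ → 0 ≤ η → η ≤ 1 / 16 →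
      ∀ Φ₁ Φ₂ Ψ₁ Ψ₂ : PeriodicTrialState N L,
        (∫ X in cellN N L, conj (Φ₁.ψ X) * Φ₂.ψ X = 0) → (∫ X in cellN N L, conj (Ψ₁.ψ X) * Ψ₂.ψ X = 0) →
        periodicEnergy (fun r => min (v r) (m : ℝ≥0∞)) Φ₁ + periodicEnergy (fun r => min (v r) (m : ℝ≥0∞)) Φ₂ ≤
          kyFanTwo (fun r => min (v r) (m : ℝ≥0∞)) N L + ENNReal.ofReal δ →
        periodicEnergy (fun r => min (v r) (n : ℝ≥0∞)) Ψ₁ + periodicEnergy (fun r => min (v r) (n : ℝ≥0∞)) Ψ₂ ≤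
          kyFanTwo (fun r => min (v r) (n : ℝ≥0∞)) N L + ENNReal.ofReal δ →
        kyFanTwo (fun r => min (v r) (n : ℝ≥0∞)) N L ≠ ⊤ →
        ∫⁻ X in cellN N L, ((‖Ψ₁.ψ X - Φ₁.ψ X‖₊ : ℝ≥0∞)) ^ 2 ≤ ENNReal.ofReal η →
        ∫⁻ X in cellN N L, ((‖Ψ₂.ψ X - Φ₂.ψ X‖₊ : ℝ≥0∞)) ^ 2 ≤ ENNReal.ofReal η →
        (∫⁻ X in cellN N L, kineticDensity (fun Y => Ψ₁.ψ Y - Φ₁.ψ Y) X +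
            periodicInteraction (fun r => min (v r) (m : ℝ≥0∞)) L X * ((‖Ψ₁.ψ X - Φ₁.ψ X‖₊ : ℝ≥0∞)) ^ 2) +
          (∫⁻ X in cellN N L, kineticDensity (fun Y => Ψ₂.ψ Y - Φ₂.ψ Y) X +
            periodicInteraction (fun r => min (v r) (m : ℝ≥0∞)) L X * ((‖Ψ₂.ψ X - Φ₂.ψ X‖₊ : ℝ≥0∞)) ^ 2) ≤
          2 * (kyFanTwo (fun r => min (v r) (n : ℝ≥0∞)) N L - kyFanTwo (fun r => min (v r) (m : ℝ≥0∞)) N L) +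
            4 * ENNReal.ofReal δ +
            ENNReal.ofReal (64 * Real.sqrt η) * (kyFanTwo (fun r => min (v r) (n : ℝ≥0∞)) N L + ENNReal.ofReal δ) := by
  intro hGS v hv N L hL m n hmn δ η _hδ hη hη16 Φ₁ Φ₂ Ψ₁ Ψ₂ hΦorth hΨorth hΦopt hΨopt hKtop hd₁ hd₂
  -- the two truncations `wₘ ≤ wₙ`
  set wm : ℝ → ℝ≥0∞ := fun r => min (v r) (m : ℝ≥0∞) with hwm
  set wn : ℝ → ℝ≥0∞ := fun r => min (v r) (n : ℝ≥0∞) with hwn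
  have hwm_meas : Measurable wm := hv.min measurable_const
  have hle : ∀ r, wm r ≤ wn r := fun r => by
    simp only [hwm, hwn]
    exact min_le_min le_rfl (by exact_mod_cast hmn)
  have hKmn : kyFanTwo wm N L ≤ kyFanTwo wn N L := kyFanTwo_mono_of_le hle
  -- (1) the parallelogram law for the `wₘ`-form on each component, and `q_{wₘ}(Ψᵢ) ≤ q_{wₙ}(Ψᵢ)`
  have hpar₁ := lintegral_periodicEnergy_add_add_sub hwm_meas L Ψ₁.contDiff Φ₁.contDiff
  have hpar₂ := lintegral_periodicEnergy_add_add_sub hwm_meas L Ψ₂.contDiff Φ₂.contDiff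
  have hA : periodicEnergy wm Ψ₁ + periodicEnergy wm Ψ₂ ≤ kyFanTwo wn N L + ENNReal.ofReal δ :=
    (add_le_add (periodicEnergy_mono_of_le hle Ψ₁) (periodicEnergy_mono_of_le hle Ψ₂)).trans hΨopt
  -- (2) Gram–Schmidt on the half sums `uᵢ = (Ψᵢ + Φᵢ)/2`
  obtain ⟨hc_sq, hc_n⟩ := half_facts
  set c : ℂ := ((1 / 2 : ℝ) : ℂ)
  obtain ⟨hu₁, hper₁, hsy₁⟩ := halfSum_regular Ψ₁ Φ₁ c
  obtain ⟨hu₂, hper₂, hsy₂⟩ := halfSum_regular Ψ₂ Φ₂ c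
  obtain ⟨hm₁l, hm₁u⟩ := halfSum_mass_bounds Ψ₁ Φ₁ hc_sq hη hη16 hd₁
  obtain ⟨hm₂l, hm₂u⟩ := halfSum_mass_bounds Ψ₂ Φ₂ hc_sq hη hη16 hd₂
  have hov := norm_integral_halfSum_overlap_le Φ₁ Φ₂ Ψ₁ Ψ₂ hc_n hη hΦorth hΨorth hd₁ hd₂
  have hs0 : 0 ≤ Real.sqrt η / 2 := by positivity
  have hs8 : Real.sqrt η / 2 ≤ 1 / 8 := by
    have h : Real.sqrt η ≤ 1 / 4 :=
      (Real.sqrt_le_left (by norm_num)).2 (hη16.trans (by norm_num))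
    linarith
  obtain ⟨f₁, f₂, hf, hE⟩ := hGS wm hwm_meas N L hL (Real.sqrt η / 2) hs0 hs8 _ _ hu₁ hu₂ hper₁ hper₂
    hsy₁ hsy₂ hm₁l hm₁u hm₂l hm₂u hov
  rw [lintegral_periodicEnergy_const_mul wm L c (Ψ₁.contDiff.add Φ₁.contDiff),
    lintegral_periodicEnergy_const_mul wm L c (Ψ₂.contDiff.add Φ₂.contDiff), hc_sq] at hE
  have hK : kyFanTwo wm N L ≤ periodicEnergy wm f₁ + periodicEnergy wm f₂ :=
    iInf_le_of_le f₁ (iInf_le_of_le f₂ (iInf_le_of_le hf le_rfl))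
  -- (3) the real constants and the `ℝ≥0∞` bookkeeping
  have h16 : ENNReal.ofReal (1 + 32 * (Real.sqrt η / 2)) = 1 + ENNReal.ofReal (16 * Real.sqrt η) := by
    rw [show (1 : ℝ) + 32 * (Real.sqrt η / 2) = 1 + 16 * Real.sqrt η by ring,
      ENNReal.ofReal_add zero_le_one (by positivity), ENNReal.ofReal_one]
  have h64 : ENNReal.ofReal (16 * Real.sqrt η) * 4 = ENNReal.ofReal (64 * Real.sqrt η) := by
    rw [show (64 : ℝ) * Real.sqrt η = 16 * Real.sqrt η * 4 by ring,
      ENNReal.ofReal_mul' (by norm_num : (0 : ℝ) ≤ 4), ENNReal.ofReal_ofNat]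
  exact bookkeeping hKmn hKtop hpar₁ hpar₂ hA hΦopt (hK.trans hE) h16 h64

end Summit.AtomisticToContinuum.BoseEinsteinCondensation.Cruxes.HardCoreExtension.ThirdLawCurrentFloor

end
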